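import Literature.Analysis.FluidPDE.GalerkinSmoothLimit
import Literature.Analysis.FluidPDE.CorrectorFourierEstimates
import HarnessLib

/-!
# Smooth short-time solutions by the Fourier–Galerkin energy method, IV: the limit solves the
# system mode by mode

Analysis/FluidPDE proof file (theorems only), sequel of `GalerkinSmoothLimit.lean`. For the data of
`GalerkinSmooth.exists_galerkinLimit` (Galerkin solutions `βⁿ` of the damped system on
`freqBall n`, uniform weighted bounds `R_m`, Cauchy rate `η_n → 0`, limit coefficient curve `c`),
this file proves the **differential equation of the limit within `[0, T]`**, at every frequency
`k` (A. J. Majda, A. L. Bertozzi, *Vorticity and Incompressible Flow*, CUP 2002, proof of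
Thm. 3.4, pp. 109–110: passage to the limit in the regularised equations):

`∂ₜ c(t)_k = -ν4π²|k|² c(t)_k + Π_k(-σ_k c(t)_k - N(c(t))_k)`,
`N(c)_{k,p} = ∑ⱼ ∑ₘ c_{m,j} 2πi(k-m)ⱼ c_{k-m,p}` (`galerkinLimit_hasDerivWithinAt`).

The nonlinearity is written with the tree's lattice transport symbol `ScalarFourier.transportSym`
(the Fourier side of `u·∇θ`, `ScalarFourierDefs`), component by component: the truncated
convection symbol of the Galerkin field *is* that transport symbol for finitely supported
coefficients (`convectionCoeff_apply_eq_transportSym`), so the Galerkin right-hand sides converge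
to the limit right-hand side uniformly on `[0, T]` by the weighted sup-norm bounds of
`ScalarFourier.hasDecay_transportSym` (the weighted `ℓ²` bounds of part III give every weighted
sup-norm decay `FourierNS.HasDecay`, and the `ℓ²`-Cauchy rate interpolates to decay of the
differences); the Galerkin equations integrated in time (fundamental theorem of calculus) pass to
the limit, and the integrated limit equation is differentiated within `[0, T]` (continuity of the
limit right-hand side on `[0, T]`, `ScalarFourier.continuousOn_lconv_param`).

This is the input of the time-regularity bootstrap (`ScalarFourier.IsCoeffFamily`,
`ScalarFourierFamily` / `ScalarFourierSynthesis`) in the sequel.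

## References

* A. J. Majda, A. L. Bertozzi, *Vorticity and Incompressible Flow*, CUP 2002, §3.2.2, Thm. 3.4,
  proof pp. 108–110. [`MajdaBertozziCUP2002`]
* J. C. Robinson, J. L. Rodrigo, W. Sadowski, *The three-dimensional Navier–Stokes equations*,
  CUP 2016, §4.1, (4.5). [`RobinsonRodrigoSadowski2016`]
-/

noncomputable section

open MeasureTheory Set Filter Topology Function UnitAddTorus Metric intervalIntegral
open scoped ENNReal NNReal InnerProductSpace ContDiff

namespace Literature.Analysis.FluidPDE

namespace GalerkinSmooth

open FunctionSpaces FunctionSpaces.Torus Torus EulerGalerkin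
open FourierNS (HasDecay clamp)
open ScalarFourier (lconv dsym transportSym latOrder latMass)

variable {d : Type*} [Fintype d] [DecidableEq d]

/-! ## The convection symbol as a transport symbol -/

section Algebra

omit [DecidableEq d] in
/-- **The Galerkin convection symbol is the lattice transport symbol**, component by component:
for a family `c̄` supported in the finite set `S`,
`(convectionCoeff S c̄ c̄ k)_p = N(U, c̄_p)(k)` with `U j m = c̄ m j` and
`N(U, θ)(k) = ∑ⱼ ∑ₘ U j m · 2πi (k-m)ⱼ θ(k-m)` (`ScalarFourier.transportSym`): the `p`-th
component of `𝓕[(u·∇)u](k)` is `𝓕[u·∇u_p](k)`. [folklore] -/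
theorem convectionCoeff_apply_eq_transportSym {S : Finset (d → ℤ)} (b : ↥S → EuclideanSpace ℂ d)
    (k : d → ℤ) (p : d) :
    convectionCoeff S (coeffExt S b) (coeffExt S b) k p =
      transportSym (fun j m => coeffExt S b m j) (fun m => coeffExt S b m p) k := by
  classical
  rw [convectionCoeff_def, ScalarFourier.transportSym_apply]
  -- the finite double sum: `∑_{l∈S} ∑_{m∈S} [l+m=k] X l m = ∑_{l∈S} X l (k-l)`
  have hinner : ∀ l ∈ S, (∑ m ∈ S, (if l + m = k then
      (2 * Real.pi * Complex.I * ∑ j, coeffExt S b l j * (m j : ℂ)) • coeffExt S b m else 0)) p =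
      (2 * Real.pi * Complex.I * ∑ j, coeffExt S b l j * ((k - l) j : ℂ)) * coeffExt S b (k - l) p := by
    intro l _
    have hcond : ∀ m, (l + m = k) ↔ (k - l = m) := fun m => by
      constructor
      · intro h; rw [← h]; abel
      · intro h; rw [← h]; abel
    simp only [hcond]
    rw [Finset.sum_ite_eq]
    by_cases hk : k - l ∈ S
    · rw [if_pos hk, PiLp.smul_apply, smul_eq_mul]
    · rw [if_neg hk, coeffExt_of_not_mem b hk]
      simp
  rw [show (∑ l ∈ S, ∑ m ∈ S, (if l + m = k then
      (2 * Real.pi * Complex.I * ∑ j, coeffExt S b l j * (m j : ℂ)) • coeffExt S b m else 0)) p =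
      ∑ l ∈ S, (∑ m ∈ S, (if l + m = k then
        (2 * Real.pi * Complex.I * ∑ j, coeffExt S b l j * (m j : ℂ)) • coeffExt S b m else 0)) p by
    simp [Finset.sum_apply], Finset.sum_congr rfl hinner]
  -- the lattice side: the `tsum` over `l` is a finite sum over `S`
  have hts : ∀ j, lconv (fun m => coeffExt S b m j) (fun m => dsym j m * coeffExt S b m p) k =
      ∑ l ∈ S, coeffExt S b l j * (dsym j (k - l) * coeffExt S b (k - l) p) := by
    intro j
    rw [ScalarFourier.lconv_apply, tsum_eq_sum]
    intro l hl
    rw [coeffExt_of_not_mem b hl]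
    simp
  simp only [hts]
  rw [Finset.sum_comm]
  refine Finset.sum_congr rfl fun l _ => ?_
  simp only [ScalarFourier.dsym_apply, Finset.mul_sum, Finset.sum_mul, Pi.sub_apply, Int.cast_sub]
  refine Finset.sum_congr rfl fun j _ => ?_
  ring

omit [DecidableEq d] in
/-- **Sup-norm bound of the transport symbol** (`ScalarFourier.hasDecay_transportSym` at order
`0`): `‖N(U, c)(k)‖ ≤ #d · latMass · (A (2πX₀) + A₀ (2πX))`. [folklore] -/
theorem norm_transportSym_le {U : d → (d → ℤ) → ℂ} {c : (d → ℤ) → ℂ} {A₀ A X₀ X : ℝ}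
    (hU₀ : ∀ j, HasDecay (latOrder d) A₀ (U j)) (hU : ∀ j, HasDecay 0 A (U j)) (hA : 0 ≤ A)
    (hc₀ : HasDecay (latOrder d + 1) X₀ c) (hc : HasDecay (0 + 1) X c) (hX : 0 ≤ X) (k : d → ℤ) :
    ‖transportSym U c k‖ ≤ Fintype.card d * (latMass d * (A * (2 * Real.pi * X₀) + A₀ * (2 * Real.pi * X))) := by
  have h := (ScalarFourier.hasDecay_transportSym hU₀ hU hA hc₀ hc hX).norm_le k
  simpa using h

omit [DecidableEq d] in
/-- The Euclidean norm of a vector is at most `√#d` times a common bound of its components. [folklore] -/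
theorem norm_toLp_le_of_forall_le {v : d → ℂ} {δ : ℝ} (hδ : 0 ≤ δ) (h : ∀ p, ‖v p‖ ≤ δ) :
    ‖(WithLp.toLp 2 v : EuclideanSpace ℂ d)‖ ≤ Real.sqrt (Fintype.card d) * δ := by
  rw [EuclideanSpace.norm_eq]
  have h1 : ∑ p, ‖(WithLp.toLp 2 v : EuclideanSpace ℂ d) p‖ ^ 2 ≤ Fintype.card d * δ ^ 2 := by
    calc ∑ p, ‖(WithLp.toLp 2 v : EuclideanSpace ℂ d) p‖ ^ 2 ≤ ∑ _p : d, δ ^ 2 :=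
          Finset.sum_le_sum fun p _ => pow_le_pow_left₀ (norm_nonneg _) (h p) 2
      _ = Fintype.card d * δ ^ 2 := by rw [Finset.sum_const, Finset.card_univ, nsmul_eq_mul]
  calc Real.sqrt (∑ p, ‖(WithLp.toLp 2 v : EuclideanSpace ℂ d) p‖ ^ 2) ≤ Real.sqrt (Fintype.card d * δ ^ 2) :=
        Real.sqrt_le_sqrt h1
    _ = Real.sqrt (Fintype.card d) * δ := by rw [Real.sqrt_mul (Nat.cast_nonneg _), Real.sqrt_sq hδ]

end Algebra

/-! ## The differential equation of the limit -/

section ODE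

variable {ν : ℝ} {σ : (d → ℤ) → ℝ} {T : ℝ}
  {β : (n : ℕ) → ℝ → ↥(freqBall (d := d) n) → EuclideanSpace ℂ d}
  {c : ℝ → (d → ℤ) → EuclideanSpace ℂ d} {R : ℕ → ℝ} {η : ℕ → ℝ}

/-- Decay of a family from the bounds on its weighted partial sums over singletons. [folklore] -/
theorem hasDecay_of_forall_sum_le {g : (d → ℤ) → EuclideanSpace ℂ d} {Rb : ℕ → ℝ}
    (h : ∀ (m : ℕ) (F : Finset (d → ℤ)), ∑ k ∈ F, (1 + freqNormSq k) ^ m * ‖g k‖ ^ 2 ≤ Rb m) (p : ℕ) :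
    HasDecay (2 * p) (2 ^ p * Real.sqrt (Rb (2 * p))) g :=
  hasDecay_of_weighted_sq_le fun k => by simpa using h (2 * p) {k}

omit [DecidableEq d] in
/-- Components of a decaying `ℂ^d`-valued family decay with the same constant. [folklore] -/
theorem hasDecay_apply {K : ℕ} {C : ℝ} {g : (d → ℤ) → EuclideanSpace ℂ d} (h : HasDecay K C g) (j : d) :
    HasDecay K C (fun m => g m j) := fun m => (PiLp.norm_apply_le (g m) j).trans (h m)

set_option maxHeartbeats 400000 in
/-- **The Galerkin limit solves the limit system, mode by mode, within `[0, T]`** (Majda–Bertozzi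
2002, proof of Thm. 3.4, pp. 109–110: passing to the limit in the regularised equations; here on
the Fourier side: the Galerkin equations integrated in time converge, the right-hand sides
converging uniformly on `[0, T]` because the truncated convection symbol is the lattice transport
symbol `N(û, û_p)` (`convectionCoeff_apply_eq_transportSym`), which is Lipschitz in the weighted
sup norms (`ScalarFourier.hasDecay_transportSym`), and the fundamental theorem of calculus). For
the data of `exists_galerkinLimit`:
`∂ₜ c(t)_k = -ν4π²|k|² c(t)_k + Π_k(-σ_k c(t)_k - N(c(t))_k)` within `[0,T]`, with
`N(c)_{k,p} = ∑ⱼ ∑ₘ c_{m,j} 2πi (k-m)ⱼ c_{k-m,p}`. [cite: MajdaBertozziCUP2002, Thm. 3.4 proof (pp. 109–110)] -/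
theorem galerkinLimit_hasDerivWithinAt (hν : 0 ≤ ν) (hσ : ∀ k, 0 ≤ σ k) (hT0 : 0 ≤ T)
    (hβcont : ∀ n, Continuous (β n))
    (hβderiv : ∀ n, ∀ t ∈ Icc 0 T, HasDerivWithinAt (β n)
      (galerkinRHS (freqBall n) ν (fun k : ↥(freqBall (d := d) n) => -((((σ (k : d → ℤ)) : ℝ) : ℂ) • β n t k))
        (β n t)) (Icc 0 T) t)
    (hR : ∀ m n, ∀ t ∈ Icc 0 T,
      ∑ k ∈ freqBall n, (1 + freqNormSq k) ^ m * ‖coeffExt (freqBall n) (β n t) k‖ ^ 2 ≤ R m)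
    (hηt : Tendsto η atTop (𝓝 0))
    (herr : ∀ n, ∀ t ∈ Icc 0 T, ∀ k, ‖c t k - coeffExt (freqBall n) (β n t) k‖ ^ 2 ≤ η n)
    (hcbound : ∀ m, ∀ t ∈ Icc 0 T, ∀ F : Finset (d → ℤ), ∑ k ∈ F, (1 + freqNormSq k) ^ m * ‖c t k‖ ^ 2 ≤ R m)
    (hccont : ∀ k, ContinuousOn (fun t => c t k) (Icc 0 T)) (k : d → ℤ) {t : ℝ} (ht : t ∈ Icc 0 T) :
    HasDerivWithinAt (fun s => c s k)
      (-((((ν * (4 * Real.pi ^ 2 * freqNormSq k)) : ℝ) : ℂ) • c t k) +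
        leraySym k (-((((σ k) : ℝ)) : ℂ) • c t k -
          WithLp.toLp 2 (fun p => transportSym (fun j m => c t m j) (fun m => c t m p) k)))
      (Icc 0 T) t := by
  have h0T : (0 : ℝ) ∈ Icc 0 T := ⟨le_rfl, hT0⟩
  -- the approximants
  set f : ℕ → ℝ → (d → ℤ) → EuclideanSpace ℂ d := fun n t k => coeffExt (freqBall n) (β n t) k with hf
  have hη0 : ∀ n, 0 ≤ η n := fun n => le_trans (sq_nonneg _) (herr n 0 h0T k)
  have hR0 : ∀ m, 0 ≤ R m := fun m => le_trans (by simp) (hcbound m 0 h0T ∅)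
  have hfcont : ∀ n l, Continuous fun s => f n s l := by
    intro n l
    by_cases hl : l ∈ freqBall (d := d) n
    · simp only [hf, coeffExt_of_mem _ hl]; exact (continuous_apply _).comp (hβcont n)
    · simp only [hf, coeffExt_of_not_mem _ hl]; exact continuous_const
  have hfbound : ∀ m n, ∀ s ∈ Icc 0 T, ∀ F : Finset (d → ℤ), ∑ l ∈ F, (1 + freqNormSq l) ^ m * ‖f n s l‖ ^ 2 ≤ R m :=
    fun m n s hs F => (sum_coeffExt_le_sum (F := F) (fun l => (1 + freqNormSq l) ^ m)
      (fun l => pow_nonneg (by linarith [freqNormSq_nonneg l]) _) (β n s)).trans (hR m n s hs)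
  -- decay of `c`, of `f n` and of their difference
  have hdc : ∀ p, ∀ s ∈ Icc 0 T, HasDecay (2 * p) (2 ^ p * Real.sqrt (R (2 * p))) (c s) :=
    fun p s hs => hasDecay_of_forall_sum_le (fun m F => hcbound m s hs F) p
  have hdf : ∀ p n, ∀ s ∈ Icc 0 T, HasDecay (2 * p) (2 ^ p * Real.sqrt (R (2 * p))) (f n s) :=
    fun p n s hs => hasDecay_of_forall_sum_le (fun m F => hfbound m n s hs F) p
  set θ : ℕ → ℕ → ℝ := fun p n => Real.sqrt (η n * (4 * R (4 * p))) with hθ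
  have hθ0 : ∀ p n, 0 ≤ θ p n := fun p n => Real.sqrt_nonneg _
  have hθt : ∀ p, Tendsto (θ p) atTop (𝓝 0) := fun p => by
    have := (hηt.mul_const (4 * R (4 * p))).sqrt
    simpa [hθ] using this
  have hdδ : ∀ p n, ∀ s ∈ Icc 0 T, HasDecay (2 * p) (2 ^ p * Real.sqrt (θ p n)) (fun m => f n s m - c s m) := by
    intro p n s hs
    refine hasDecay_of_weighted_sq_le fun m => ?_
    have h1 : ‖f n s m - c s m‖ ^ 2 ≤ η n := by rw [norm_sub_rev]; exact herr n s hs m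
    have h2 : (1 + freqNormSq m) ^ (4 * p) * ‖f n s m - c s m‖ ^ 2 ≤ 4 * R (4 * p) := by
      have hf1 : (1 + freqNormSq m) ^ (4 * p) * ‖f n s m‖ ^ 2 ≤ R (4 * p) := by simpa using hfbound (4 * p) n s hs {m}
      have hc1 : (1 + freqNormSq m) ^ (4 * p) * ‖c s m‖ ^ 2 ≤ R (4 * p) := by simpa using hcbound (4 * p) s hs {m}
      have hw : 0 ≤ (1 + freqNormSq m) ^ (4 * p) := pow_nonneg (by linarith [freqNormSq_nonneg m]) _
      have hn : ‖f n s m - c s m‖ ^ 2 ≤ 2 * ‖f n s m‖ ^ 2 + 2 * ‖c s m‖ ^ 2 := by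
        have h3 : ‖f n s m - c s m‖ ^ 2 ≤ (‖f n s m‖ + ‖c s m‖) ^ 2 :=
          pow_le_pow_left₀ (norm_nonneg _) (norm_sub_le _ _) 2
        nlinarith [h3, sq_nonneg (‖f n s m‖ - ‖c s m‖)]
      nlinarith [mul_le_mul_of_nonneg_left hn hw]
    have hw2 : 0 ≤ (1 + freqNormSq m) ^ (2 * p) * ‖f n s m - c s m‖ ^ 2 :=
      mul_nonneg (pow_nonneg (by linarith [freqNormSq_nonneg m]) _) (sq_nonneg _)
    have hsq : ((1 + freqNormSq m) ^ (2 * p) * ‖f n s m - c s m‖ ^ 2) ^ 2 ≤ η n * (4 * R (4 * p)) := by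
      calc ((1 + freqNormSq m) ^ (2 * p) * ‖f n s m - c s m‖ ^ 2) ^ 2
          = ‖f n s m - c s m‖ ^ 2 * ((1 + freqNormSq m) ^ (4 * p) * ‖f n s m - c s m‖ ^ 2) := by
            rw [show 4 * p = 2 * p + 2 * p by ring, pow_add]; ring
        _ ≤ η n * (4 * R (4 * p)) :=
            mul_le_mul h1 h2 (mul_nonneg (pow_nonneg (by linarith [freqNormSq_nonneg m]) _) (sq_nonneg _)) (hη0 n)
    calc (1 + freqNormSq m) ^ (2 * p) * ‖f n s m - c s m‖ ^ 2
        = Real.sqrt (((1 + freqNormSq m) ^ (2 * p) * ‖f n s m - c s m‖ ^ 2) ^ 2) := (Real.sqrt_sq hw2).symm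
      _ ≤ θ p n := Real.sqrt_le_sqrt hsq
  -- Step 2: the right-hand sides
  set P : ℕ := Fintype.card d with hP
  have hlat : latOrder d = 2 * P := rfl
  -- the limit right-hand side
  set Nv : ℝ → EuclideanSpace ℂ d := fun s =>
    WithLp.toLp 2 (fun p => transportSym (fun j m => c s m j) (fun m => c s m p) k) with hNv
  set G : ℝ → EuclideanSpace ℂ d := fun s =>
    -((((ν * (4 * Real.pi ^ 2 * freqNormSq k)) : ℝ) : ℂ) • c s k) +
      leraySym k (-((((σ k) : ℝ)) : ℂ) • c s k - Nv s) with hG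
  -- the Galerkin right-hand sides
  set Gn : ℕ → ℝ → EuclideanSpace ℂ d := fun n s =>
    galerkinField ν (freqBall n) (fun m => -((((σ m) : ℝ)) : ℂ) • f n s m) (f n s) k with hGn
  have hGn_eq : ∀ n s, Gn n s = -((((ν * (4 * Real.pi ^ 2 * freqNormSq k)) : ℝ) : ℂ) • f n s k) +
      leraySym k (-((((σ k) : ℝ)) : ℂ) • f n s k -
        WithLp.toLp 2 (fun p => transportSym (fun j m => f n s m j) (fun m => f n s m p) k)) := by
    intro n s
    simp only [hGn, galerkinField_def]
    congr 2
    rw [sub_right_inj]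
    ext p
    rw [WithLp.ofLp_toLp]
    exact convectionCoeff_apply_eq_transportSym (β n s) k p
  -- decay data in the orders used by the transport-symbol bounds
  have hA0 : 0 ≤ 2 ^ P * Real.sqrt (R (2 * P)) := by positivity
  have hUdec : ∀ s ∈ Icc 0 T, ∀ j, HasDecay (latOrder d) (2 ^ P * Real.sqrt (R (2 * P))) (fun m => c s m j) :=
    fun s hs j => hlat ▸ hasDecay_apply (hdc P s hs) j
  have hUdec0 : ∀ s ∈ Icc 0 T, ∀ j, HasDecay 0 (2 ^ 0 * Real.sqrt (R (2 * 0))) (fun m => c s m j) :=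
    fun s hs j => hasDecay_apply (hdc 0 s hs) j
  have hUndec : ∀ n, ∀ s ∈ Icc 0 T, ∀ j, HasDecay (latOrder d) (2 ^ P * Real.sqrt (R (2 * P))) (fun m => f n s m j) :=
    fun n s hs j => hlat ▸ hasDecay_apply (hdf P n s hs) j
  have hUndec0 : ∀ n, ∀ s ∈ Icc 0 T, ∀ j, HasDecay 0 (2 ^ 0 * Real.sqrt (R (2 * 0))) (fun m => f n s m j) :=
    fun n s hs j => hasDecay_apply (hdf 0 n s hs) j
  have hcdec1 : ∀ s ∈ Icc 0 T, ∀ p, HasDecay (latOrder d + 1) (2 ^ (P + 1) * Real.sqrt (R (2 * (P + 1)))) (fun m => c s m p) :=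
    fun s hs p => (hasDecay_apply (hdc (P + 1) s hs) p).of_le (by rw [hlat]; omega)
  have hcdec1' : ∀ s ∈ Icc 0 T, ∀ p, HasDecay (0 + 1) (2 ^ 1 * Real.sqrt (R (2 * 1))) (fun m => c s m p) :=
    fun s hs p => (hasDecay_apply (hdc 1 s hs) p).of_le (by omega)
  have hδdec : ∀ n, ∀ s ∈ Icc 0 T, ∀ j, HasDecay (latOrder d) (2 ^ P * Real.sqrt (θ P n)) (fun m => f n s m j - c s m j) :=
    fun n s hs j => hlat ▸ hasDecay_apply (hdδ P n s hs) j
  have hδdec0 : ∀ n, ∀ s ∈ Icc 0 T, ∀ j, HasDecay 0 (2 ^ 0 * Real.sqrt (θ 0 n)) (fun m => f n s m j - c s m j) :=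
    fun n s hs j => hasDecay_apply (hdδ 0 n s hs) j
  have hδdec1 : ∀ n, ∀ s ∈ Icc 0 T, ∀ p, HasDecay (latOrder d + 1) (2 ^ (P + 1) * Real.sqrt (θ (P + 1) n)) (fun m => f n s m p - c s m p) :=
    fun n s hs p => (hasDecay_apply (hdδ (P + 1) n s hs) p).of_le (by rw [hlat]; omega)
  have hδdec1' : ∀ n, ∀ s ∈ Icc 0 T, ∀ p, HasDecay (0 + 1) (2 ^ 1 * Real.sqrt (θ 1 n)) (fun m => f n s m p - c s m p) :=
    fun n s hs p => (hasDecay_apply (hdδ 1 n s hs) p).of_le (by omega)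
  -- the uniform bound on `Gn - G`
  set ρ : ℕ → ℝ := fun n =>
    (ν * (4 * Real.pi ^ 2 * freqNormSq k) + σ k) * Real.sqrt (η n) +
      Real.sqrt (Fintype.card d) *
        (Fintype.card d * (latMass d * ((2 ^ 0 * Real.sqrt (R (2 * 0))) * (2 * Real.pi * (2 ^ (P + 1) * Real.sqrt (θ (P + 1) n))) +
          (2 ^ P * Real.sqrt (R (2 * P))) * (2 * Real.pi * (2 ^ 1 * Real.sqrt (θ 1 n))))) +
        Fintype.card d * (latMass d * ((2 ^ 0 * Real.sqrt (θ 0 n)) * (2 * Real.pi * (2 ^ (P + 1) * Real.sqrt (R (2 * (P + 1))))) +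
          (2 ^ P * Real.sqrt (θ P n)) * (2 * Real.pi * (2 ^ 1 * Real.sqrt (R (2 * 1))))))) with hρ
  have hρt : Tendsto ρ atTop (𝓝 0) := by
    have hsη : Tendsto (fun n => Real.sqrt (η n)) atTop (𝓝 0) := by simpa using hηt.sqrt
    have hsθ : ∀ p, Tendsto (fun n => Real.sqrt (θ p n)) atTop (𝓝 0) := fun p => by simpa using (hθt p).sqrt
    have h := (hsη.const_mul (ν * (4 * Real.pi ^ 2 * freqNormSq k) + σ k)).add
      ((((((hsθ (P + 1)).const_mul (2 ^ (P + 1))).const_mul (2 * Real.pi)).const_mul (2 ^ 0 * Real.sqrt (R (2 * 0)))).add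
        ((((hsθ 1).const_mul (2 ^ 1)).const_mul (2 * Real.pi)).const_mul (2 ^ P * Real.sqrt (R (2 * P))))).const_mul
          (latMass d) |>.const_mul (Fintype.card d : ℝ) |>.add
        (((((hsθ 0).const_mul (2 ^ 0)).mul_const (2 * Real.pi * (2 ^ (P + 1) * Real.sqrt (R (2 * (P + 1)))))).add
          (((hsθ P).const_mul (2 ^ P)).mul_const (2 * Real.pi * (2 ^ 1 * Real.sqrt (R (2 * 1)))))).const_mul
            (latMass d) |>.const_mul (Fintype.card d : ℝ)) |>.const_mul (Real.sqrt (Fintype.card d)))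
    simp only [mul_zero, add_zero, zero_mul] at h
    exact h
  have hGdiff : ∀ n, ∀ s ∈ Icc 0 T, ‖Gn n s - G s‖ ≤ ρ n := by
    intro n s hs
    have hsq : ‖f n s k - c s k‖ ≤ Real.sqrt (η n) := by
      have h := Real.sqrt_le_sqrt (herr n s hs k)
      rwa [Real.sqrt_sq (norm_nonneg _), norm_sub_rev] at h
    -- the transport part, component by component
    have hT : ∀ p, ‖transportSym (fun j m => f n s m j) (fun m => f n s m p) k -
        transportSym (fun j m => c s m j) (fun m => c s m p) k‖ ≤
        Fintype.card d * (latMass d * ((2 ^ 0 * Real.sqrt (R (2 * 0))) * (2 * Real.pi * (2 ^ (P + 1) * Real.sqrt (θ (P + 1) n))) +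
          (2 ^ P * Real.sqrt (R (2 * P))) * (2 * Real.pi * (2 ^ 1 * Real.sqrt (θ 1 n))))) +
        Fintype.card d * (latMass d * ((2 ^ 0 * Real.sqrt (θ 0 n)) * (2 * Real.pi * (2 ^ (P + 1) * Real.sqrt (R (2 * (P + 1))))) +
          (2 ^ P * Real.sqrt (θ P n)) * (2 * Real.pi * (2 ^ 1 * Real.sqrt (R (2 * 1)))))) := by
      intro p
      have h1 : transportSym (fun j m => f n s m j) (fun m => f n s m p) k -
          transportSym (fun j m => f n s m j) (fun m => c s m p) k =
          transportSym (fun j m => f n s m j) (fun m => f n s m p - c s m p) k :=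
        ScalarFourier.transportSym_sub (hUndec n s hs) ((hasDecay_apply (hdf (P + 1) n s hs) p).of_le (by rw [hlat]; omega))
          (hcdec1 s hs p) k
      have h2 : transportSym (fun j m => f n s m j) (fun m => c s m p) k -
          transportSym (fun j m => c s m j) (fun m => c s m p) k =
          transportSym (fun j m => f n s m j - c s m j) (fun m => c s m p) k :=
        CorrectorFourier.transportSym_sub_left (hUndec n s hs) (hUdec s hs) (hcdec1 s hs p) k
      have hb1 := norm_transportSym_le (hUndec n s hs) (hUndec0 n s hs) (by positivity)
        (hδdec1 n s hs p) (hδdec1' n s hs p) (by positivity) k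
      have hb2 := norm_transportSym_le (hδdec n s hs) (hδdec0 n s hs) (by positivity)
        (hcdec1 s hs p) (hcdec1' s hs p) (by positivity) k
      calc ‖transportSym (fun j m => f n s m j) (fun m => f n s m p) k - transportSym (fun j m => c s m j) (fun m => c s m p) k‖
          = ‖(transportSym (fun j m => f n s m j) (fun m => f n s m p) k - transportSym (fun j m => f n s m j) (fun m => c s m p) k) +
              (transportSym (fun j m => f n s m j) (fun m => c s m p) k - transportSym (fun j m => c s m j) (fun m => c s m p) k)‖ := by
            abel_nf
        _ ≤ _ := norm_add_le _ _
        _ ≤ _ := by rw [h1, h2]; exact add_le_add hb1 hb2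
    have hNdiff : ‖WithLp.toLp 2 (fun p => transportSym (fun j m => f n s m j) (fun m => f n s m p) k) - Nv s‖ ≤
        Real.sqrt (Fintype.card d) *
          (Fintype.card d * (latMass d * ((2 ^ 0 * Real.sqrt (R (2 * 0))) * (2 * Real.pi * (2 ^ (P + 1) * Real.sqrt (θ (P + 1) n))) +
            (2 ^ P * Real.sqrt (R (2 * P))) * (2 * Real.pi * (2 ^ 1 * Real.sqrt (θ 1 n))))) +
          Fintype.card d * (latMass d * ((2 ^ 0 * Real.sqrt (θ 0 n)) * (2 * Real.pi * (2 ^ (P + 1) * Real.sqrt (R (2 * (P + 1))))) +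
            (2 ^ P * Real.sqrt (θ P n)) * (2 * Real.pi * (2 ^ 1 * Real.sqrt (R (2 * 1))))))) := by
      rw [hNv, ← WithLp.toLp_sub]
      refine norm_toLp_le_of_forall_le ?_ fun p => hT p
      have := ScalarFourier.latMass_nonneg (d := d); positivity
    -- assemble
    rw [hGn_eq, hG]
    have hleray : ∀ v w : EuclideanSpace ℂ d, ‖leraySym k v - leraySym k w‖ ≤ ‖v - w‖ := fun v w => by
      rw [← leraySym_sub]; exact norm_leraySym_le k _
    calc ‖-((((ν * (4 * Real.pi ^ 2 * freqNormSq k)) : ℝ) : ℂ) • f n s k) +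
          leraySym k (-((((σ k) : ℝ)) : ℂ) • f n s k -
            WithLp.toLp 2 (fun p => transportSym (fun j m => f n s m j) (fun m => f n s m p) k)) -
          (-((((ν * (4 * Real.pi ^ 2 * freqNormSq k)) : ℝ) : ℂ) • c s k) + leraySym k (-((((σ k) : ℝ)) : ℂ) • c s k - Nv s))‖
        = ‖-((((ν * (4 * Real.pi ^ 2 * freqNormSq k)) : ℝ) : ℂ) • (f n s k - c s k)) +
          (leraySym k (-((((σ k) : ℝ)) : ℂ) • f n s k -
            WithLp.toLp 2 (fun p => transportSym (fun j m => f n s m j) (fun m => f n s m p) k)) -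
            leraySym k (-((((σ k) : ℝ)) : ℂ) • c s k - Nv s))‖ := by congr 1; rw [smul_sub]; abel
      _ ≤ ‖-((((ν * (4 * Real.pi ^ 2 * freqNormSq k)) : ℝ) : ℂ) • (f n s k - c s k))‖ +
          ‖leraySym k (-((((σ k) : ℝ)) : ℂ) • f n s k -
            WithLp.toLp 2 (fun p => transportSym (fun j m => f n s m j) (fun m => f n s m p) k)) -
            leraySym k (-((((σ k) : ℝ)) : ℂ) • c s k - Nv s)‖ := norm_add_le _ _
      _ ≤ (ν * (4 * Real.pi ^ 2 * freqNormSq k)) * ‖f n s k - c s k‖ +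
          ‖(-((((σ k) : ℝ)) : ℂ) • f n s k -
            WithLp.toLp 2 (fun p => transportSym (fun j m => f n s m j) (fun m => f n s m p) k)) -
            (-((((σ k) : ℝ)) : ℂ) • c s k - Nv s)‖ := by
          refine add_le_add ?_ (hleray _ _)
          rw [norm_neg, norm_smul, Complex.norm_real, Real.norm_of_nonneg]
          exact mul_nonneg hν (mul_nonneg (by positivity) (freqNormSq_nonneg k))
      _ = (ν * (4 * Real.pi ^ 2 * freqNormSq k)) * ‖f n s k - c s k‖ +
          ‖-(((((σ k) : ℝ)) : ℂ) • (f n s k - c s k)) -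
            (WithLp.toLp 2 (fun p => transportSym (fun j m => f n s m j) (fun m => f n s m p) k) - Nv s)‖ := by
          congr 2; rw [neg_smul, neg_smul, smul_sub]; abel
      _ ≤ (ν * (4 * Real.pi ^ 2 * freqNormSq k)) * ‖f n s k - c s k‖ +
          (σ k * ‖f n s k - c s k‖ +
            ‖WithLp.toLp 2 (fun p => transportSym (fun j m => f n s m j) (fun m => f n s m p) k) - Nv s‖) := by
          refine add_le_add le_rfl ((norm_sub_le _ _).trans (add_le_add ?_ le_rfl))
          rw [norm_neg, norm_smul, Complex.norm_real, Real.norm_of_nonneg (hσ k)]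
      _ ≤ ρ n := by
          rw [hρ]
          have hν' : 0 ≤ ν * (4 * Real.pi ^ 2 * freqNormSq k) := mul_nonneg hν (mul_nonneg (by positivity) (freqNormSq_nonneg k))
          nlinarith [hsq, hNdiff, hσ k, hν', norm_nonneg (f n s k - c s k)]
  -- Step 3: the Galerkin equations integrated in time
  have hGncont : ∀ n, Continuous (Gn n) := by
    intro n
    have h := continuous_galerkinField (S := freqBall (d := d) n) ν (X := ℝ)
      (G := fun s m => -((((σ m) : ℝ)) : ℂ) • f n s m) (C := fun s => f n s)
      (fun l => (hfcont n l).const_smul (-((((σ l) : ℝ)) : ℂ))) (fun l => hfcont n l) k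
    simpa only [hGn] using h
  obtain ⟨N₀, hN₀⟩ := exists_mem_freqBall k
  have hkmem : ∀ n, N₀ ≤ n → k ∈ freqBall (d := d) n := fun n hn => freqBall_mono hn hN₀
  have hfderiv : ∀ n, N₀ ≤ n → ∀ s ∈ Icc 0 T, HasDerivWithinAt (fun s => f n s k) (Gn n s) (Icc 0 T) s := by
    intro n hn s hs
    have hk := hkmem n hn
    have h := (ContinuousLinearMap.proj (R := ℝ) (φ := fun _ : ↥(freqBall (d := d) n) => EuclideanSpace ℂ d)
      ⟨k, hk⟩).hasFDerivAt.comp_hasDerivWithinAt s (hβderiv n s hs)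
    have hfun : (fun s => f n s k) = fun s => β n s ⟨k, hk⟩ := by
      funext s; simp only [hf, coeffExt_of_mem _ hk]
    rw [hfun]
    have hval : (ContinuousLinearMap.proj (R := ℝ) (φ := fun _ : ↥(freqBall (d := d) n) => EuclideanSpace ℂ d) ⟨k, hk⟩)
        (galerkinRHS (freqBall n) ν (fun k : ↥(freqBall (d := d) n) => -((((σ (k : d → ℤ)) : ℝ) : ℂ) • β n s k)) (β n s)) =
        Gn n s := by
      rw [ContinuousLinearMap.proj_apply, galerkinRHS_apply, coeffExt_dampForce]
      simp only [hGn, hf, neg_smul]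
    rw [hval] at h
    exact h
  have hFTC : ∀ n, N₀ ≤ n → ∀ s ∈ Icc 0 T, f n s k = f n 0 k + ∫ x in (0 : ℝ)..s, Gn n x := by
    intro n hn s hs
    have h := integral_eq_sub_of_hasDeriv_right_of_le hs.1 ((hfcont n k).continuousOn)
      (fun x hx => ((hfderiv n hn x ⟨hx.1.le, hx.2.le.trans hs.2⟩).hasDerivAt
        (Icc_mem_nhds hx.1 (hx.2.trans_le hs.2))).hasDerivWithinAt)
      ((hGncont n).intervalIntegrable 0 s)
    rw [h]; abel
  -- Step 4: continuity of the limit right-hand side and the integrated limit equation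
  have hGcont : ContinuousOn G (Icc 0 T) := by
    have hc' : ∀ m j, ContinuousOn (fun s => c s m j) (Icc 0 T) := fun m j =>
      (PiLp.continuous_apply 2 _ j).comp_continuousOn (hccont m)
    have hNcomp : ∀ p, ContinuousOn (fun s => transportSym (fun j m => c s m j) (fun m => c s m p) k) (Icc 0 T) := by
      intro p
      simp only [ScalarFourier.transportSym_apply]
      refine continuousOn_finsetSum _ fun j _ => ?_
      refine ScalarFourier.continuousOn_lconv_param (F := fun s m => c s m j) (G := fun s m => dsym j m * c s m p)
        (fun m => hc' m j) (fun m => continuousOn_const.mul (hc' m p)) hA0 (fun s hs => hUdec s hs j)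
        (fun s hs m => (ScalarFourier.hasDecay_dsym_mul (hcdec1 s hs p) j).norm_le m) k
    have hNvc : ContinuousOn Nv (Icc 0 T) := by
      simp only [hNv]
      exact (PiLp.continuous_toLp 2 _).comp_continuousOn (continuousOn_pi.2 hNcomp)
    have h1 : ContinuousOn (fun s => -((((ν * (4 * Real.pi ^ 2 * freqNormSq k)) : ℝ) : ℂ) • c s k)) (Icc 0 T) :=
      ((hccont k).const_smul ((((ν * (4 * Real.pi ^ 2 * freqNormSq k)) : ℝ) : ℂ))).neg
    have h2 : ContinuousOn (fun s => -((((σ k) : ℝ)) : ℂ) • c s k - Nv s) (Icc 0 T) :=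
      ((hccont k).const_smul (-((((σ k) : ℝ)) : ℂ))).sub hNvc
    have h3 : ContinuousOn (fun s => leraySym k (-((((σ k) : ℝ)) : ℂ) • c s k - Nv s)) (Icc 0 T) :=
      (continuous_leraySym k).comp_continuousOn h2
    rw [hG]
    exact fun s hs => (h1 s hs).add (h3 s hs)
  have hflim : ∀ s ∈ Icc 0 T, Tendsto (fun n => f n s k) atTop (𝓝 (c s k)) := by
    intro s hs
    refine tendsto_iff_norm_sub_tendsto_zero.2 ?_
    refine squeeze_zero (fun n => norm_nonneg _) (fun n => ?_) (by simpa using hηt.sqrt)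
    have h := Real.sqrt_le_sqrt (herr n s hs k)
    rwa [Real.sqrt_sq (norm_nonneg _), norm_sub_rev] at h
  have hIlim : ∀ s ∈ Icc 0 T, Tendsto (fun n => ∫ x in (0 : ℝ)..s, Gn n x) atTop (𝓝 (∫ x in (0 : ℝ)..s, G x)) := by
    intro s hs
    refine tendsto_iff_norm_sub_tendsto_zero.2 ?_
    have hGi : IntervalIntegrable G volume 0 s :=
      (hGcont.mono (by rw [uIcc_of_le hs.1]; exact Icc_subset_Icc le_rfl hs.2)).intervalIntegrable
    have hlim0 : Tendsto (fun n => ρ n * |s - 0|) atTop (𝓝 0) := by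
      have := hρt.mul_const |s - 0|
      rwa [zero_mul] at this
    refine squeeze_zero (fun n => norm_nonneg _) (fun n => ?_) hlim0
    rw [← intervalIntegral.integral_sub ((hGncont n).intervalIntegrable 0 s) hGi]
    refine intervalIntegral.norm_integral_le_of_norm_le_const fun x hx => hGdiff n x ?_
    rw [uIoc_of_le hs.1] at hx
    exact ⟨hx.1.le, hx.2.trans hs.2⟩
  have hceq : ∀ s ∈ Icc 0 T, c s k = c 0 k + ∫ x in (0 : ℝ)..s, G x := by
    intro s hs
    have h1 : Tendsto (fun n => f n 0 k + ∫ x in (0 : ℝ)..s, Gn n x) atTop (𝓝 (c 0 k + ∫ x in (0 : ℝ)..s, G x)) :=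
      (hflim 0 h0T).add (hIlim s hs)
    have h2 : ∀ᶠ n in atTop, f n s k = f n 0 k + ∫ x in (0 : ℝ)..s, Gn n x :=
      Filter.eventually_atTop.2 ⟨N₀, fun n hn => hFTC n hn s hs⟩
    exact tendsto_nhds_unique (hflim s hs) (h1.congr' (h2.mono fun n hn => hn.symm))
  -- Step 5: the derivative within `[0, T]`
  set Gc : ℝ → EuclideanSpace ℂ d := fun s => G (clamp T s) with hGc
  have hGcc : Continuous Gc := hGcont.comp_continuous (FourierNS.continuous_clamp T) fun s => FourierNS.clamp_mem_Icc hT0 s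
  have hΦ : HasDerivAt (fun s => c 0 k + ∫ x in (0 : ℝ)..s, Gc x) (Gc t) t :=
    ((hGcc.integral_hasStrictDerivAt 0 t).hasDerivAt).const_add _
  have hGct : Gc t = G t := by simp only [hGc, FourierNS.clamp_of_mem ht]
  have hΦeq : ∀ s ∈ Icc 0 T, c 0 k + ∫ x in (0 : ℝ)..s, Gc x = c s k := by
    intro s hs
    rw [hceq s hs]
    congr 1
    refine intervalIntegral.integral_congr fun x hx => ?_
    rw [uIcc_of_le hs.1] at hx
    simp only [hGc, FourierNS.clamp_of_mem ⟨hx.1, hx.2.trans hs.2⟩]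
  rw [hGct] at hΦ
  have key := hΦ.hasDerivWithinAt (s := Icc 0 T)
  exact key.congr (fun s hs => (hΦeq s hs).symm) (hΦeq t ht).symm

end ODE

end GalerkinSmooth

end Literature.Analysis.FluidPDE
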